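import Summits.ResolutionOfSingularities.ResolutionOfSingularities.Theorems.FrobeniusLadderFInjectiveMacaulayficationStrictTransformChartCI
import Summits.ResolutionOfSingularities.ResolutionOfSingularities.Theorems.FrobeniusLadderFInjectiveMacaulayficationDiagonalBPCIChart5NotFull
import Summits.ResolutionOfSingularities.ResolutionOfSingularities.Theorems.FrobeniusLadderFInjectiveMacaulayficationMonicTowerPrime
import Summits.ResolutionOfSingularities.ResolutionOfSingularities.Theorems.FrobeniusLadderFInjectiveMacaulayficationCICodimTwoCM
import Summits.ResolutionOfSingularities.ResolutionOfSingularities.Theorems.FrobeniusLadderFInjectiveMacaulayficationReesChartFacts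
import HarnessLib

/-!
# CHART PACKAGE FOR TOWER BEDS: a point-blow-up chart of `X = V(F₁, F₂) ⊂ 𝔸⁶` whose strict transforms of `P = 2F₁ − F₂`, `Q = F₂ − F₁` form a monic tower
# `(y₀² − ιGⱼ, y₁³ + ιHⱼ)`, `Gⱼ, Hⱼ ∈ k[y₂..y₅]`, is `Spec k[y]/(p, q)` — and is COHEN–MACAULAY AT EVERY PRIME
# (crux `FInjectiveMacaulayfication` stmt-ResolutionOfSingularities-15315, chain w45a; res-L1-w45a-plan-1 RULING R23.11 (2) floor LEGAL column of BED CI-1; seat res-L1-w45a-stub-2 g13)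

[OURS · L1 W4.5a] Support file (`--supports stmt-ResolutionOfSingularities-15315 --as helper`); def-free; UNCONDITIONAL; replaces the role of NO printed item; NOT a statement of the
manuscript; AI-written (AI review is weaker than expert review). Nothing of the crux is proved.

GENERIC IN THE CHART: for a bed `F : Fin 2 → k[x₀..x₅]`, a chart index `j` among `2, …, 5` (`X j = ![X 2, X 3, X 4, X 5] m`), and `Gⱼ, Hⱼ ∈ C = k[X 0..X 3]` (embedded by
`ι : X m ↦ X (m+2)`) with the chart identities `θⱼ(2F₁ − F₂) = yⱼ²·(y₀² − ιGⱼ)`, `θⱼ(F₂ − F₁) = yⱼ³·(y₁³ + ιHⱼ)` and the certificates «`Gⱼ` not a square», «`−Hⱼ` not a cube»,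
`Gⱼ(0) = 0`, `1 + Hⱼ(0) ≠ 0`:
* §1 (`PQ_mem` is ✓ `DiagonalBPCIChart5NotFull.PQ_mem`) `no_square_lift` (a square root in `k[y₁..y₅]` would project to one in `C`), `prime_p` (`y₀² − ιGⱼ` is a PRIME ELEMENT, ✓ `MonicTowerPrime.prime_X0_sq_sub_rename`),
  `not_dvd_pq` (evaluate at `(0, 1, 0, 0, 0, 0)`), `cmCl_quotient_pair` — `k[y]/(p, q)` is CM at every prime (✓ `CICodimTwoCM`);
* §2 `isPrime_pair` (✓ `MonicTowerPrime.isPrime_span_tower`: `(p, q)` prime, `yⱼ ∉`), `total_transform_mem`, ★ `exists_chartEquiv` — `k[y]/(p, q) ≅ (R[𝔪t])_{(x̄ⱼt)}`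
  (✓ `StrictTransformChartCI.exists_ringEquiv_ci`);
* §3 ★★ `cmCl_reesChart` — the Rees chart `D₊(x̄ⱼt)` of `Bl_𝔪 X` is CM at EVERY prime.
[cite: Matsumura1987, Thm. 17.4 (iii)] [cite: StacksProject, Tag 0804] [folklore: Gauss's lemma, norm argument]
-/

-- single-problem summit: the doubled namespace component is forced
set_option linter.dupNamespace false

noncomputable section

namespace Summit.ResolutionOfSingularities.ResolutionOfSingularities.Theorems.FInjectiveMacaulayfication.TowerBedChartCM

open MvPolynomial IsLocalRing Literature.AlgebraicGeometry.Resolution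
open Summit.ResolutionOfSingularities.ResolutionOfSingularities.Theorems.FInjectiveMacaulayfication SliceableCentre

variable (k : Type) [Field k]

/-! ## §1 The pair `(p, q)`: `p` is a prime element, `p ∤ q`, `k[y]/(p, q)` is CM at every prime -/

/-- A square root of `ι'G` in `k[y₁, …, y₅]` (`ι' : X m ↦ X (m+1)`) projects (`y₁ ↦ 0`, `y_{m+1} ↦ y_m`) to a square root of `G` in `C = k[X 0..X 3]`. [elementary] -/
theorem no_square_lift (G : MvPolynomial (Fin 4) k) (hG : ∀ y : MvPolynomial (Fin 4) k, y ^ 2 ≠ G) (s : MvPolynomial (Fin 5) k) :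
    s ^ 2 ≠ MvPolynomial.eval₂Hom MvPolynomial.C ![MvPolynomial.X 1, MvPolynomial.X 2, MvPolynomial.X 3, MvPolynomial.X 4] G := by
  intro h
  set π' : MvPolynomial (Fin 5) k →+* MvPolynomial (Fin 4) k := MvPolynomial.eval₂Hom MvPolynomial.C ![0, X 0, X 1, X 2, X 3] with hπ'
  have hcomp : π'.comp (MvPolynomial.eval₂Hom MvPolynomial.C ![MvPolynomial.X 1, MvPolynomial.X 2, MvPolynomial.X 3, MvPolynomial.X 4]) =
      RingHom.id _ := by
    refine MvPolynomial.ringHom_ext (fun a => ?_) (fun m => ?_)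
    · rw [RingHom.comp_apply, MvPolynomial.eval₂Hom_C, hπ', MvPolynomial.eval₂Hom_C, RingHom.id_apply]
    · rw [RingHom.comp_apply, MvPolynomial.eval₂Hom_X', RingHom.id_apply]
      fin_cases m <;> simp [hπ']
  have h1 := congrArg π' h
  rw [map_pow, ← RingHom.comp_apply, hcomp, RingHom.id_apply] at h1
  exact hG _ h1

/-- `rename succ ∘ ι' = ι` on `C = k[X 0..X 3]` (`ι : X m ↦ X (m+2)` into six variables). [plumbing] -/
theorem rename_succ_iota' (G : MvPolynomial (Fin 4) k) :
    MvPolynomial.rename Fin.succ (MvPolynomial.eval₂Hom MvPolynomial.C ![MvPolynomial.X 1, MvPolynomial.X 2, MvPolynomial.X 3, MvPolynomial.X 4] G) =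
      (MvPolynomial.eval₂Hom MvPolynomial.C ![MvPolynomial.X 2, MvPolynomial.X 3, MvPolynomial.X 4, MvPolynomial.X 5] G : MvPolynomial (Fin 6) k) := by
  change ((MvPolynomial.rename Fin.succ).toRingHom.comp
    (MvPolynomial.eval₂Hom MvPolynomial.C ![MvPolynomial.X 1, MvPolynomial.X 2, MvPolynomial.X 3, MvPolynomial.X 4])) G = _
  congr 1
  refine MvPolynomial.ringHom_ext (fun a => ?_) (fun m => ?_)
  · rw [RingHom.comp_apply, MvPolynomial.eval₂Hom_C, MvPolynomial.eval₂Hom_C]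
    exact MvPolynomial.rename_C _ a
  · rw [RingHom.comp_apply, MvPolynomial.eval₂Hom_X', MvPolynomial.eval₂Hom_X']
    fin_cases m <;> simp

/-- ★ **`p = y₀² − ιG` is a PRIME ELEMENT of `k[y₀, …, y₅]`** when `G ∈ C` is not a square. [folklore: Gauss] -/
theorem prime_p (G : MvPolynomial (Fin 4) k) (hG : ∀ y : MvPolynomial (Fin 4) k, y ^ 2 ≠ G) :
    Prime ((X 0 : MvPolynomial (Fin 6) k) ^ 2 -
      MvPolynomial.eval₂Hom MvPolynomial.C ![MvPolynomial.X 2, MvPolynomial.X 3, MvPolynomial.X 4, MvPolynomial.X 5] G) := by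
  rw [← rename_succ_iota']
  exact MonicTowerPrime.prime_X0_sq_sub_rename k _ (no_square_lift k G hG)

/-- Evaluation of `ιG` at a point with vanishing last four coordinates is `G(0)`. [plumbing] -/
theorem eval_iota_eq_constantCoeff (G : MvPolynomial (Fin 4) k) (c : Fin 6 → k) (hc2 : c 2 = 0) (hc3 : c 3 = 0) (hc4 : c 4 = 0) (hc5 : c 5 = 0) :
    MvPolynomial.eval c (MvPolynomial.eval₂Hom MvPolynomial.C ![MvPolynomial.X 2, MvPolynomial.X 3, MvPolynomial.X 4, MvPolynomial.X 5] G) =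
      constantCoeff G := by
  rw [show MvPolynomial.eval c (MvPolynomial.eval₂Hom MvPolynomial.C ![MvPolynomial.X 2, MvPolynomial.X 3, MvPolynomial.X 4, MvPolynomial.X 5] G) =
      ((MvPolynomial.eval c).comp (MvPolynomial.eval₂Hom MvPolynomial.C ![MvPolynomial.X 2, MvPolynomial.X 3, MvPolynomial.X 4, MvPolynomial.X 5])) G from rfl,
    MvPolynomial.comp_eval₂Hom, ← MvPolynomial.eval_zero]
  congr 1
  refine MvPolynomial.ringHom_ext (fun a => ?_) (fun m => ?_)
  · rw [MvPolynomial.eval₂Hom_C, RingHom.comp_apply, MvPolynomial.eval_C, MvPolynomial.eval_C]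
  · rw [MvPolynomial.eval₂Hom_X', MvPolynomial.eval_X, Pi.zero_apply]
    fin_cases m <;> simp [hc2, hc3, hc4, hc5]

/-- **`p ∤ q`**: at the point `(0, 1, 0, 0, 0, 0)` one has `p = −G(0) = 0` and `q = 1 + H(0) ≠ 0`. [elementary] -/
theorem not_dvd_pq (G H : MvPolynomial (Fin 4) k) (hG0 : constantCoeff G = 0) (hH1 : 1 + constantCoeff H ≠ 0) :
    ¬ ((X 0 : MvPolynomial (Fin 6) k) ^ 2 - MvPolynomial.eval₂Hom MvPolynomial.C ![MvPolynomial.X 2, MvPolynomial.X 3, MvPolynomial.X 4, MvPolynomial.X 5] G) ∣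
      ((X 1 : MvPolynomial (Fin 6) k) ^ 3 + MvPolynomial.eval₂Hom MvPolynomial.C ![MvPolynomial.X 2, MvPolynomial.X 3, MvPolynomial.X 4, MvPolynomial.X 5] H) := by
  refine MonicTowerPrime.not_dvd_of_eval k _ _ (fun i : Fin 6 => if i = 1 then (1 : k) else 0) ?_ ?_
  · rw [map_sub, map_pow, MvPolynomial.eval_X, eval_iota_eq_constantCoeff k G _ (by simp) (by simp) (by simp) (by simp), hG0]
    simp
  · rw [map_add, map_pow, MvPolynomial.eval_X, eval_iota_eq_constantCoeff k H _ (by simp) (by simp) (by simp) (by simp)]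
    simpa using hH1

/-- ★ **`k[y]/(p, q)` IS CM AT EVERY PRIME** (`p` prime element, `p ∤ q`: ✓ `CICodimTwoCM.cmCl_localization_of_prime_of_not_dvd`), in the `Set.range` presentation of the pair.
[cite: Matsumura1987, Thm. 17.4 (iii)] -/
theorem cmCl_quotient_pair (g : Fin 2 → MvPolynomial (Fin 6) k) (hprime : Prime (g 0)) (hndvd : ¬ g 0 ∣ g 1)
    (Q : Ideal (MvPolynomial (Fin 6) k ⧸ Ideal.span (Set.range g))) [Q.IsPrime] : CMCl (Localization.AtPrime Q) := by
  have hrange : Ideal.span (Set.range g) = Ideal.span {g 0, g 1} := by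
    congr 1
    ext z
    simp only [Set.mem_range, Fin.exists_fin_two, Set.mem_insert_iff, Set.mem_singleton_iff]
    constructor
    · rintro (h | h) <;> [exact Or.inl h.symm; exact Or.inr h.symm]
    · rintro (h | h) <;> [exact Or.inl h.symm; exact Or.inr h.symm]
  exact ReesChartFacts.transport_cmCl (Ideal.quotEquivOfEq hrange.symm) (fun Q' _ => CICodimTwoCM.cmCl_localization_of_prime_of_not_dvd k (g 0) (g 1) hprime hndvd Q') Q

/-! ## §2 The pair is prime; the chart presentation -/

/-- `Set.range ![a, b] = {a, b}`-type bookkeeping for a `Fin 2`-family. [plumbing] -/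
theorem range_fin_two (g : Fin 2 → MvPolynomial (Fin 6) k) : Set.range g = {g 0, g 1} := by
  ext z
  simp only [Set.mem_range, Fin.exists_fin_two, Set.mem_insert_iff, Set.mem_singleton_iff]
  constructor
  · rintro (h | h) <;> [exact Or.inl h.symm; exact Or.inr h.symm]
  · rintro (h | h) <;> [exact Or.inl h.symm; exact Or.inr h.symm]

/-- ★ **`(p, q)` IS PRIME and `yⱼ ∉ (p, q)`** for `j ∈ {2, …, 5}` (✓ `MonicTowerPrime.isPrime_span_tower`). [folklore] -/
theorem isPrime_pair (G H : MvPolynomial (Fin 4) k) (hG : ∀ y : MvPolynomial (Fin 4) k, y ^ 2 ≠ G) (hH : ∀ y : MvPolynomial (Fin 4) k, y ^ 3 + H ≠ 0)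
    (g : Fin 2 → MvPolynomial (Fin 6) k)
    (hg0 : g 0 = (X 0 : MvPolynomial (Fin 6) k) ^ 2 - MvPolynomial.eval₂Hom MvPolynomial.C ![MvPolynomial.X 2, MvPolynomial.X 3, MvPolynomial.X 4, MvPolynomial.X 5] G)
    (hg1 : g 1 = (X 1 : MvPolynomial (Fin 6) k) ^ 3 + MvPolynomial.eval₂Hom MvPolynomial.C ![MvPolynomial.X 2, MvPolynomial.X 3, MvPolynomial.X 4, MvPolynomial.X 5] H)
    (j : Fin 6) (m : Fin 4) (hjm : (![X 2, X 3, X 4, X 5] m : MvPolynomial (Fin 6) k) = X j) :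
    (Ideal.span (Set.range g)).IsPrime ∧ (X j : MvPolynomial (Fin 6) k) ∉ Ideal.span (Set.range g) := by
  have hI : Ideal.span (Set.range g) = Ideal.span {(MvPolynomial.X 0 : MvPolynomial (Fin 6) k) ^ 2 -
        MvPolynomial.eval₂Hom MvPolynomial.C ![MvPolynomial.X 2, MvPolynomial.X 3, MvPolynomial.X 4, MvPolynomial.X 5] G,
      (MvPolynomial.X 1 : MvPolynomial (Fin 6) k) ^ 3 +
        MvPolynomial.eval₂Hom MvPolynomial.C ![MvPolynomial.X 2, MvPolynomial.X 3, MvPolynomial.X 4, MvPolynomial.X 5] H} := by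
    rw [range_fin_two, hg0, hg1]
  obtain ⟨hprime, hX⟩ := MonicTowerPrime.isPrime_span_tower k G H hG hH _ hI
  exact ⟨hprime, hjm ▸ hX m⟩

section Chart

variable (F : Fin 2 → MvPolynomial (Fin 6) k) (j : Fin 6) (G H : MvPolynomial (Fin 4) k) (g : Fin 2 → MvPolynomial (Fin 6) k)
  (hg0 : g 0 = (X 0 : MvPolynomial (Fin 6) k) ^ 2 - MvPolynomial.eval₂Hom MvPolynomial.C ![MvPolynomial.X 2, MvPolynomial.X 3, MvPolynomial.X 4, MvPolynomial.X 5] G)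
  (hg1 : g 1 = (X 1 : MvPolynomial (Fin 6) k) ^ 3 + MvPolynomial.eval₂Hom MvPolynomial.C ![MvPolynomial.X 2, MvPolynomial.X 3, MvPolynomial.X 4, MvPolynomial.X 5] H)
  (hθP : aeval (fun i : Fin 6 => if i = j then (X j : MvPolynomial (Fin 6) k) else X i * X j) (C 2 * F 0 - F 1) = X j ^ 2 * g 0)
  (hθQ : aeval (fun i : Fin 6 => if i = j then (X j : MvPolynomial (Fin 6) k) else X i * X j) (F 1 - F 0) = X j ^ 3 * g 1)

include hθP hθQ

/-- The chart identities in the shape ✓ `StrictTransformChartCI.exists_ringEquiv_ci` wants. [plumbing] -/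
theorem theta_PQ : ∀ l : Fin 2,
    (aeval (fun i : Fin 6 => if i = j then (X j : MvPolynomial (Fin 6) k) else X i * X j)).toRingHom
      ((![C 2 * F 0 - F 1, F 1 - F 0] : Fin 2 → MvPolynomial (Fin 6) k) l) = X j ^ ((![2, 3] : Fin 2 → ℕ) l) * g l := by
  refine Fin.forall_fin_two.mpr ⟨?_, ?_⟩
  · simp only [Matrix.cons_val_zero]
    exact hθP
  · simp only [Matrix.cons_val_one, Matrix.cons_val_zero]
    exact hθQ

/-- **The total transforms of `F₁ = P + Q`, `F₂ = P + 2Q` lie in `(p, q)`.** [folklore] -/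
theorem total_transform_mem : ∀ s ∈ Ideal.span (Set.range F),
    (aeval (fun i : Fin 6 => if i = j then (X j : MvPolynomial (Fin 6) k) else X i * X j)).toRingHom s ∈ Ideal.span (Set.range g) := by
  have hm0 : g 0 ∈ Ideal.span (Set.range g) := Ideal.subset_span ⟨0, rfl⟩
  have hm1 : g 1 ∈ Ideal.span (Set.range g) := Ideal.subset_span ⟨1, rfl⟩
  set θ : MvPolynomial (Fin 6) k →+* MvPolynomial (Fin 6) k :=
    (aeval (fun i : Fin 6 => if i = j then (X j : MvPolynomial (Fin 6) k) else X i * X j)).toRingHom with hθ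
  have hP : θ ((C 2 : MvPolynomial (Fin 6) k) * F 0 - F 1) = X j ^ 2 * g 0 := hθP
  have hQ : θ (F 1 - F 0) = X j ^ 3 * g 1 := hθQ
  have e0 : F 0 = ((C 2 : MvPolynomial (Fin 6) k) * F 0 - F 1) + (F 1 - F 0) := by simp only [map_ofNat]; ring
  have e1 : F 1 = ((C 2 : MvPolynomial (Fin 6) k) * F 0 - F 1) + (C 2 : MvPolynomial (Fin 6) k) * (F 1 - F 0) := by simp only [map_ofNat]; ring
  have hF0 : θ (F 0) ∈ Ideal.span (Set.range g) := by
    rw [e0, map_add, hP, hQ]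
    exact add_mem (Ideal.mul_mem_left _ _ hm0) (Ideal.mul_mem_left _ _ hm1)
  have hF1 : θ (F 1) ∈ Ideal.span (Set.range g) := by
    rw [e1, map_add, map_mul, hP, hQ]
    exact add_mem (Ideal.mul_mem_left _ _ hm0) (Ideal.mul_mem_left _ _ (Ideal.mul_mem_left _ _ hm1))
  intro s hs
  have h1 : θ s ∈ (Ideal.span (Set.range F)).map θ := Ideal.mem_map_of_mem θ hs
  rw [Ideal.map_span] at h1
  refine (Ideal.span_le.mpr ?_) h1
  rintro _ ⟨_, ⟨l, rfl⟩, rfl⟩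
  rw [SetLike.mem_coe]
  revert l
  exact Fin.forall_fin_two.mpr ⟨hF0, hF1⟩

include hg0 hg1

/-- ★ **THE CHART PRESENTATION `k[y]/(p, q) ≅ (R[𝔪t])_{(x̄ⱼt)}`** (`(p, q)` prime with `yⱼ ∉`, ✓ `StrictTransformChartCI.exists_ringEquiv_ci`). [cite: StacksProject, Tag 0804] -/
theorem exists_chartEquiv (hG : ∀ y : MvPolynomial (Fin 4) k, y ^ 2 ≠ G) (hH : ∀ y : MvPolynomial (Fin 4) k, y ^ 3 + H ≠ 0)
    (m : Fin 4) (hjm : (![X 2, X 3, X 4, X 5] m : MvPolynomial (Fin 6) k) = X j) :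
    ∃ e : (MvPolynomial (Fin 6) k ⧸ Ideal.span (Set.range g)) ≃+*
        HomogeneousLocalization.Away (reesGrading (Ideal.span (Set.range fun i : Fin 6 => Ideal.Quotient.mk (Ideal.span (Set.range F)) (X i))))
          (reesT ((fun i : Fin 6 => Ideal.Quotient.mk (Ideal.span (Set.range F)) (X i)) j) (Ideal.subset_span (Set.mem_range_self j))),
      e (Ideal.Quotient.mk (Ideal.span (Set.range g)) (X j)) =
        reesChartBase ((fun i : Fin 6 => Ideal.Quotient.mk (Ideal.span (Set.range F)) (X i)) j) (Ideal.subset_span (Set.mem_range_self j))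
          ((fun i : Fin 6 => Ideal.Quotient.mk (Ideal.span (Set.range F)) (X i)) j) := by
  obtain ⟨hJ, hXj⟩ := isPrime_pair k G H hG hH g hg0 hg1 j m hjm
  exact StrictTransformChartCI.exists_ringEquiv_ci (Ideal.Quotient.mk (Ideal.span (Set.range F))) Ideal.Quotient.mk_surjective
    (fun i : Fin 6 => Ideal.Quotient.mk (Ideal.span (Set.range F)) (X i)) (fun i => rfl)
    (I := Ideal.span (Set.range F)) (J := Ideal.span (Set.range g)) (fun s => Ideal.Quotient.eq_zero_iff_mem) hJ hXj
    (aeval fun i : Fin 6 => if i = j then (X j : MvPolynomial (Fin 6) k) else X i * X j).toRingHom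
    (fun a => MvPolynomial.algHom_C _ a) ((MvPolynomial.aeval_X _ j).trans (if_pos rfl))
    (fun i hi => (MvPolynomial.aeval_X _ i).trans (if_neg hi)) (total_transform_mem k F j g hθP hθQ)
    ![C 2 * F 0 - F 1, F 1 - F 0] g ![2, 3] (DiagonalBPCIChart5NotFull.PQ_mem k F) (theta_PQ k F j g hθP hθQ) le_rfl

/-! ## §3 ★★ The Rees chart is CM at every prime -/

/-- ★★ **THE REES CHART `D₊(x̄ⱼt)` OF `Bl_𝔪 X` IS CM AT EVERY PRIME** (tower chart data for `j ∈ {2, …, 5}`; `Gⱼ` no square, `−Hⱼ` no cube, `Gⱼ(0) = 0`, `1 + Hⱼ(0) ≠ 0`).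
[folklore assembly; cite: Matsumura1987, Thm. 17.4 (iii); StacksProject, Tag 0804] -/
theorem cmCl_reesChart (hG : ∀ y : MvPolynomial (Fin 4) k, y ^ 2 ≠ G) (hH : ∀ y : MvPolynomial (Fin 4) k, y ^ 3 + H ≠ 0)
    (hG0 : constantCoeff G = 0) (hH1 : 1 + constantCoeff H ≠ 0)
    (m : Fin 4) (hjm : (![X 2, X 3, X 4, X 5] m : MvPolynomial (Fin 6) k) = X j)
    (q : Ideal (HomogeneousLocalization.Away (reesGrading (Ideal.span (Set.range fun i : Fin 6 => Ideal.Quotient.mk (Ideal.span (Set.range F)) (X i))))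
      (reesT ((fun i : Fin 6 => Ideal.Quotient.mk (Ideal.span (Set.range F)) (X i)) j) (Ideal.subset_span (Set.mem_range_self j))))) [q.IsPrime] :
    CMCl (Localization.AtPrime q) := by
  obtain ⟨e, -⟩ := exists_chartEquiv k F j G H g hg0 hg1 hθP hθQ hG hH m hjm
  have hp : Prime (g 0) := by rw [hg0]; exact prime_p k G hG
  have hnd : ¬ g 0 ∣ g 1 := by rw [hg0, hg1]; exact not_dvd_pq k G H hG0 hH1
  exact ReesChartFacts.transport_cmCl e (fun Q _ => cmCl_quotient_pair k g hp hnd Q) q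

end Chart

end Summit.ResolutionOfSingularities.ResolutionOfSingularities.Theorems.FInjectiveMacaulayfication.TowerBedChartCM

end
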